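import Summits.CriticalPhenomena.PercolationContinuityZ3.Theorems.PercNearOneGluingNoHeavyLowerTailSahiE4UnionTwoCoinXMeasureA
import Summits.CriticalPhenomena.PercolationContinuityZ3.Theorems.PercNearOneGluingNoHeavyLowerTailSahiE4UnionTwoCoinXMeasureB
import Summits.CriticalPhenomena.PercolationContinuityZ3.Theorems.PercNearOneGluingNoHeavyLowerTailSahiE4UnionTwoCoinXMeasureC
import Summits.CriticalPhenomena.PercolationContinuityZ3.Theorems.PercNearOneGluingNoHeavyLowerTailSahiE3UnionTensorMeasure
import Summits.CriticalPhenomena.PercolationContinuityZ3.Theorems.PercNearOneGluingNoHeavyLowerTailSahiE4UnionRowFacts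
import Mathlib.Tactic.FinCases
import Mathlib.Tactic.LinearCombination
import HarnessLib

/-!
# `NoHeavyLowerTail` (crux stmt-CriticalPhenomena-4575), Sahi programme P4 — ★ `H₄⁺` is preserved by the OR with the independent TWO-COIN block
# `b = (c₁ ∨ c₂, c₁c₂, c₁, c₂)` (a four-member block that is NOT a read-once OR of partial coins)

Support file (cell `prim-l12`, seat P4, generation 39; `--supports stmt-CriticalPhenomena-4575`).  No definitions, no named facts, no sorries;
standard axioms.  `γ` a finite preorder with a positively associated probability weight `μ` (`SahiPositive μ 2`), `a : Fin 4 → γ → [0,1]` monotone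
with `H4Plus μ a`; `β` ANY finite type with a probability weight `ν` and two `{0,1}`-valued events `c₁, c₂` independent under `ν`; the block
`b = (c₁ ∨ c₂, c₁c₂, c₁, c₂)`, `u_i(x,y) = a_i(x) + b_i(y) − a_i(x)b_i(y)`.  THEOREM `h4Plus_orTwoCoinX`: `H4Plus (μ⊗ν) u`.  Ingredients: `E₄` and the six
product rows from `…TwoCoinXMeasureA/B/C` (Bernstein split of generation 39), the four `E₃` rows of the sub-triples from the three-member OR step
`SahiE3UnionTensor.sahiE_three_por_nonneg` (generation 32) with the block-side rows of the two-coin sub-triples as explicit polynomial facts in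
`(E c₁, E c₂) ∈ [0,1]²` (Bernstein certificates), Harris rows of `a` from positive association.  With `h4Plus_orBlock` (blocks missing a member),
`h4Plus_orCoinFour` and the three two-coin blocks X, Y, Y2 of this generation, `H₄⁺` is closed under the OR with EVERY block built from two
independent coins (seat memo of generation 39: the remaining two-coin blocks are chains, miss a member, or are read-once ORs of partial coins).
HONEST FRAMING: the general four-member step of the closure programme is open; nothing here is Sahi's conjecture `C₄` itself. [this work]
-/

noncomputable section

namespace Summit.CriticalPhenomena.PercolationContinuityZ3.Theorems.SahiH4Plus

open Finset Function Literature.Combinatorics.Sahi2008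
open Summit.CriticalPhenomena.PercolationContinuityZ3.Theorems.SahiE3UnionTensor (ex_add' ex_sub')
open Summit.CriticalPhenomena.PercolationContinuityZ3.Theorems.SahiE4UnionHold
open Summit.CriticalPhenomena.PercolationContinuityZ3.Theorems.SahiE4UnionTwoCoin

variable {γ β : Type*} [Fintype γ] [Fintype β] [Preorder γ]

set_option maxHeartbeats 1600000 in
/-- **`H₄⁺` is preserved by the OR with the independent two-coin block `b = (c₁ ∨ c₂, c₁c₂, c₁, c₂)`.** [this work] -/
theorem h4Plus_orTwoCoinX (μ : γ → ℝ) (ν : β → ℝ)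
    (hμ0 : ∀ t, 0 ≤ μ t) (hμ1 : ∑ t, μ t = 1) (hν0 : ∀ t, 0 ≤ ν t) (hν1 : ∑ t, ν t = 1) (hμ2 : SahiPositive μ 2)
    (a : Fin 4 → γ → ℝ) (b : Fin 4 → β → ℝ) (ha0 : ∀ i t, 0 ≤ a i t) (ha1 : ∀ i t, a i t ≤ 1) (ham : ∀ i, Monotone (a i))
    (c₁ c₂ : β → ℝ) (hc₁ : ∀ y, c₁ y = 0 ∨ c₁ y = 1) (hc₂ : ∀ y, c₂ y = 0 ∨ c₂ y = 1) (hind : ex ν (c₁ * c₂) = ex ν c₁ * ex ν c₂)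
    (hb0 : b 0 = c₁ + c₂ - c₁ * c₂) (hb1 : b 1 = c₁ * c₂) (hb2 : b 2 = c₁) (hb3 : b 3 = c₂) (h : H4Plus μ a) :
    H4Plus (fun p : γ × β => μ p.1 * ν p.2) (fun (i : Fin 4) (p : γ × β) => a i p.1 + b i p.2 - a i p.1 * b i p.2) := by
  have h10 : 0 ≤ ex ν c₁ := ex_nonneg hν0 (fun y => by rcases hc₁ y with e | e <;> simp [e])
  have h11 : ex ν c₁ ≤ 1 := by
    have t := ex_mono hν0 (fun y => show c₁ y ≤ (fun _ => (1:ℝ)) y by rcases hc₁ y with e | e <;> simp [e]); rw [ex_const hν1] at t; exact t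
  have h20 : 0 ≤ ex ν c₂ := ex_nonneg hν0 (fun y => by rcases hc₂ y with e | e <;> simp [e])
  have h21 : ex ν c₂ ≤ 1 := by
    have t := ex_mono hν0 (fun y => show c₂ y ≤ (fun _ => (1:ℝ)) y by rcases hc₂ y with e | e <;> simp [e]); rw [ex_const hν1] at t; exact t
  have h1c : 0 ≤ 1 - ex ν c₁ := by linarith
  have h2c : 0 ≤ 1 - ex ν c₂ := by linarith
  have mb0 : ex ν (b 0) = ex ν c₁ + ex ν c₂ - ex ν c₁ * ex ν c₂ := by rw [hb0, show (c₁ + c₂ - c₁ * c₂ : β → ℝ) = (fun y => (c₁) y + (c₂) y - (c₁ * c₂) y) from by funext y; rfl, ex_sub', ex_add', hind]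
  have mb1 : ex ν (b 1) = ex ν c₁ * ex ν c₂ := by rw [hb1, hind]
  have mb2 : ex ν (b 2) = ex ν c₁ := by rw [hb2]
  have mb3 : ex ν (b 3) = ex ν c₂ := by rw [hb3]
  have mb01 : ex ν (b 0 * b 1) = ex ν c₁ * ex ν c₂ := by
    have e : (b 0 * b 1 : β → ℝ) = c₁ * c₂ := by
      funext y; simp only [hb0, hb1, Pi.mul_apply, Pi.add_apply, Pi.sub_apply]
      all_goals (rcases hc₁ y with h1 | h1 <;> rcases hc₂ y with h2 | h2 <;> simp [h1, h2])
    rw [e, hind]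
  have mb02 : ex ν (b 0 * b 2) = ex ν c₁ := by
    have e : (b 0 * b 2 : β → ℝ) = c₁ := by
      funext y; simp only [hb0, hb2, Pi.mul_apply, Pi.add_apply, Pi.sub_apply]
      all_goals (rcases hc₁ y with h1 | h1 <;> rcases hc₂ y with h2 | h2 <;> simp [h1, h2])
    rw [e]
  have mb03 : ex ν (b 0 * b 3) = ex ν c₂ := by
    have e : (b 0 * b 3 : β → ℝ) = c₂ := by
      funext y; simp only [hb0, hb3, Pi.mul_apply, Pi.add_apply, Pi.sub_apply]
      all_goals (rcases hc₁ y with h1 | h1 <;> rcases hc₂ y with h2 | h2 <;> simp [h1, h2])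
    rw [e]
  have mb12 : ex ν (b 1 * b 2) = ex ν c₁ * ex ν c₂ := by
    have e : (b 1 * b 2 : β → ℝ) = c₁ * c₂ := by
      funext y; simp only [hb1, hb2, Pi.mul_apply]
      all_goals (rcases hc₁ y with h1 | h1 <;> rcases hc₂ y with h2 | h2 <;> simp [h1, h2])
    rw [e, hind]
  have mb13 : ex ν (b 1 * b 3) = ex ν c₁ * ex ν c₂ := by
    have e : (b 1 * b 3 : β → ℝ) = c₁ * c₂ := by
      funext y; simp only [hb1, hb3, Pi.mul_apply]
      all_goals (rcases hc₁ y with h1 | h1 <;> rcases hc₂ y with h2 | h2 <;> simp [h1, h2])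
    rw [e, hind]
  have mb23 : ex ν (b 2 * b 3) = ex ν c₁ * ex ν c₂ := by
    have e : (b 2 * b 3 : β → ℝ) = c₁ * c₂ := by
      funext y; simp only [hb2, hb3, Pi.mul_apply]
    rw [e, hind]
  have mb012 : ex ν (b 0 * b 1 * b 2) = ex ν c₁ * ex ν c₂ := by
    have e : (b 0 * b 1 * b 2 : β → ℝ) = c₁ * c₂ := by
      funext y; simp only [hb0, hb1, hb2, Pi.mul_apply, Pi.add_apply, Pi.sub_apply]
      all_goals (rcases hc₁ y with h1 | h1 <;> rcases hc₂ y with h2 | h2 <;> simp [h1, h2])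
    rw [e, hind]
  have mb013 : ex ν (b 0 * b 1 * b 3) = ex ν c₁ * ex ν c₂ := by
    have e : (b 0 * b 1 * b 3 : β → ℝ) = c₁ * c₂ := by
      funext y; simp only [hb0, hb1, hb3, Pi.mul_apply, Pi.add_apply, Pi.sub_apply]
      all_goals (rcases hc₁ y with h1 | h1 <;> rcases hc₂ y with h2 | h2 <;> simp [h1, h2])
    rw [e, hind]
  have mb023 : ex ν (b 0 * b 2 * b 3) = ex ν c₁ * ex ν c₂ := by
    have e : (b 0 * b 2 * b 3 : β → ℝ) = c₁ * c₂ := by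
      funext y; simp only [hb0, hb2, hb3, Pi.mul_apply, Pi.add_apply, Pi.sub_apply]
      all_goals (rcases hc₁ y with h1 | h1 <;> rcases hc₂ y with h2 | h2 <;> simp [h1, h2])
    rw [e, hind]
  have mb123 : ex ν (b 1 * b 2 * b 3) = ex ν c₁ * ex ν c₂ := by
    have e : (b 1 * b 2 * b 3 : β → ℝ) = c₁ * c₂ := by
      funext y; simp only [hb1, hb2, hb3, Pi.mul_apply]
      all_goals (rcases hc₁ y with h1 | h1 <;> rcases hc₂ y with h2 | h2 <;> simp [h1, h2])
    rw [e, hind]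
  have mb0123 : ex ν (b 0 * b 1 * b 2 * b 3) = ex ν c₁ * ex ν c₂ := by
    have e : (b 0 * b 1 * b 2 * b 3 : β → ℝ) = c₁ * c₂ := by
      funext y; simp only [hb0, hb1, hb2, hb3, Pi.mul_apply, Pi.add_apply, Pi.sub_apply]
      all_goals (rcases hc₁ y with h1 | h1 <;> rcases hc₂ y with h2 | h2 <;> simp [h1, h2])
    rw [e, hind]
  have hc0 : ∀ y, 0 ≤ c₁ y ∧ c₁ y ≤ 1 ∧ 0 ≤ c₂ y ∧ c₂ y ≤ 1 := fun y => by
    rcases hc₁ y with e | e <;> rcases hc₂ y with f | f <;> rw [e, f] <;> norm_num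
  have hb0' : ∀ i t, 0 ≤ b i t := by
    intro i t; obtain ⟨p1, p2, p3, p4⟩ := hc0 t
    have e0 := congrFun hb0 t; have e1 := congrFun hb1 t; have e2 := congrFun hb2 t; have e3 := congrFun hb3 t
    simp only [Pi.add_apply, Pi.sub_apply, Pi.mul_apply] at e0 e1
    fin_cases i
    · exact (show 0 ≤ b 0 t by rw [e0]; nlinarith [mul_nonneg p1 p3, mul_nonneg (sub_nonneg.2 p2) (sub_nonneg.2 p4), mul_nonneg p1 (sub_nonneg.2 p4), mul_nonneg p3 (sub_nonneg.2 p2)])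
    · exact (show 0 ≤ b 1 t by rw [e1]; nlinarith [mul_nonneg p1 p3, mul_nonneg (sub_nonneg.2 p2) (sub_nonneg.2 p4), mul_nonneg p1 (sub_nonneg.2 p4), mul_nonneg p3 (sub_nonneg.2 p2)])
    · exact (show 0 ≤ b 2 t by rw [e2]; nlinarith [mul_nonneg p1 p3, mul_nonneg (sub_nonneg.2 p2) (sub_nonneg.2 p4), mul_nonneg p1 (sub_nonneg.2 p4), mul_nonneg p3 (sub_nonneg.2 p2)])
    · exact (show 0 ≤ b 3 t by rw [e3]; nlinarith [mul_nonneg p1 p3, mul_nonneg (sub_nonneg.2 p2) (sub_nonneg.2 p4), mul_nonneg p1 (sub_nonneg.2 p4), mul_nonneg p3 (sub_nonneg.2 p2)])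
  have hb1' : ∀ i t, b i t ≤ 1 := by
    intro i t; obtain ⟨p1, p2, p3, p4⟩ := hc0 t
    have e0 := congrFun hb0 t; have e1 := congrFun hb1 t; have e2 := congrFun hb2 t; have e3 := congrFun hb3 t
    simp only [Pi.add_apply, Pi.sub_apply, Pi.mul_apply] at e0 e1
    fin_cases i
    · exact (show b 0 t ≤ 1 by rw [e0]; nlinarith [mul_nonneg p1 p3, mul_nonneg (sub_nonneg.2 p2) (sub_nonneg.2 p4), mul_nonneg p1 (sub_nonneg.2 p4), mul_nonneg p3 (sub_nonneg.2 p2)])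
    · exact (show b 1 t ≤ 1 by rw [e1]; nlinarith [mul_nonneg p1 p3, mul_nonneg (sub_nonneg.2 p2) (sub_nonneg.2 p4), mul_nonneg p1 (sub_nonneg.2 p4), mul_nonneg p3 (sub_nonneg.2 p2)])
    · exact (show b 2 t ≤ 1 by rw [e2]; nlinarith [mul_nonneg p1 p3, mul_nonneg (sub_nonneg.2 p2) (sub_nonneg.2 p4), mul_nonneg p1 (sub_nonneg.2 p4), mul_nonneg p3 (sub_nonneg.2 p2)])
    · exact (show b 3 t ≤ 1 by rw [e3]; nlinarith [mul_nonneg p1 p3, mul_nonneg (sub_nonneg.2 p2) (sub_nonneg.2 p4), mul_nonneg p1 (sub_nonneg.2 p4), mul_nonneg p3 (sub_nonneg.2 p2)])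
  have tri : ∀ (i j k : Fin 4), 0 ≤ sahiE μ 3 ![a i, a j, a k] →
      ex μ (a i) * ex μ (a j) ≤ ex μ (a i * a j) → ex μ (a i) * ex μ (a k) ≤ ex μ (a i * a k) → ex μ (a j) * ex μ (a k) ≤ ex μ (a j * a k) →
      ex μ (a j * a k) * ex μ (a i) ≤ ex μ (a i * a j * a k) → ex μ (a i * a k) * ex μ (a j) ≤ ex μ (a i * a j * a k) →
      ex μ (a i * a j) * ex μ (a k) ≤ ex μ (a i * a j * a k) →
      ex ν (b i) * ex ν (b j) ≤ ex ν (b i * b j) → ex ν (b i) * ex ν (b k) ≤ ex ν (b i * b k) → ex ν (b j) * ex ν (b k) ≤ ex ν (b j * b k) →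
      ex ν (b j * b k) * ex ν (b i) ≤ ex ν (b i * b j * b k) → ex ν (b i * b k) * ex ν (b j) ≤ ex ν (b i * b j * b k) →
      ex ν (b i * b j) * ex ν (b k) ≤ ex ν (b i * b j * b k) → 0 ≤ sahiE ν 3 ![b i, b j, b k] →
      0 ≤ sahiE (fun p : γ × β => μ p.1 * ν p.2) 3 ![(fun (i : Fin 4) (p : γ × β) => a i p.1 + b i p.2 - a i p.1 * b i p.2) i, (fun (i : Fin 4) (p : γ × β) => a i p.1 + b i p.2 - a i p.1 * b i p.2) j, (fun (i : Fin 4) (p : γ × β) => a i p.1 + b i p.2 - a i p.1 * b i p.2) k] := by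
    intro i j k he k1 k2 k3 r0 r1 r2 l1 l2 l3 s0 s1 s2 heb
    have h3 := SahiE3UnionTensor.sahiE_three_por_nonneg μ ν hμ0 hμ1 hν0 hν1 ![a i, a j, a k] ![b i, b j, b k]
      (fun l t => by fin_cases l <;> exact ha0 _ t) (fun l t => by fin_cases l <;> exact ha1 _ t)
      (fun l t => by fin_cases l <;> exact hb0' _ t) (fun l t => by fin_cases l <;> exact hb1' _ t)
      k1 k2 k3 r0 r1 r2 he l1 l2 l3 s0 s1 s2 heb
    have e : (fun (l : Fin 3) (p : γ × β) => (![a i, a j, a k] : Fin 3 → γ → ℝ) l p.1 + (![b i, b j, b k] : Fin 3 → β → ℝ) l p.2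
        - (![a i, a j, a k] : Fin 3 → γ → ℝ) l p.1 * (![b i, b j, b k] : Fin 3 → β → ℝ) l p.2)
        = ![(fun (i : Fin 4) (p : γ × β) => a i p.1 + b i p.2 - a i p.1 * b i p.2) i, (fun (i : Fin 4) (p : γ × β) => a i p.1 + b i p.2 - a i p.1 * b i p.2) j, (fun (i : Fin 4) (p : γ × β) => a i p.1 + b i p.2 - a i p.1 * b i p.2) k] := by
      funext l p; fin_cases l <;> rfl
    rw [e] at h3; exact h3
  have R : ∀ (i j : Fin 4), ex μ (a i) * ex μ (a j) ≤ ex μ (a i * a j) := fun i j =>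
    SahiE3UnionTensor.ex_mul_le_of_sahiPositive_two μ hμ2 (a i) (a j) (ha0 i) (ha0 j) (ham i) (ham j)
  have R21 : ∀ (i j k : Fin 4), ex μ (a j * a k) * ex μ (a i) ≤ ex μ (a i * a j * a k) := by
    intro i j k
    have hjk0 : ∀ t, 0 ≤ (a j * a k) t := fun t => mul_nonneg (ha0 j t) (ha0 k t)
    have hjkm : Monotone (a j * a k) := (ham j).mul (ham k) (ha0 j) (ha0 k)
    have t := SahiE3UnionTensor.ex_mul_le_of_sahiPositive_two μ hμ2 (a i) (a j * a k) (ha0 i) hjk0 (ham i) hjkm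
    have e : a i * (a j * a k) = a i * a j * a k := by funext t; simp only [Pi.mul_apply]; ring
    rw [e] at t; linarith
  have R21b : ∀ (i j k : Fin 4), ex μ (a i * a k) * ex μ (a j) ≤ ex μ (a i * a j * a k) := by
    intro i j k
    have t := R21 j i k
    have e : a j * a i * a k = a i * a j * a k := by funext t; simp only [Pi.mul_apply]; ring
    rw [e] at t; linarith
  have R21c : ∀ (i j k : Fin 4), ex μ (a i * a j) * ex μ (a k) ≤ ex μ (a i * a j * a k) := by
    intro i j k
    have t := R21 k i j
    have e : a k * a i * a j = a i * a j * a k := by funext t; simp only [Pi.mul_apply]; ring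
    rw [e] at t; linarith
  refine ⟨?_, ?_, ?_, ?_, ?_, ?_, ?_, ?_, ?_, ?_, ?_⟩
  · exact tri 0 1 2 h.e3_012 (R 0 1) (R 0 2) (R 1 2) (R21 0 1 2) (R21b 0 1 2) (R21c 0 1 2)
      (by
      rewrite [mb0, mb1, mb01]
      have w0 := mul_nonneg (mul_nonneg (pow_nonneg h10 1) (pow_nonneg h1c 1)) (mul_nonneg (pow_nonneg h20 1) (pow_nonneg h2c 1))
      linear_combination w0)
      (by
      rewrite [mb0, mb2, mb02]
      have w0 := mul_nonneg (mul_nonneg (pow_nonneg h10 1) (pow_nonneg h1c 1)) (mul_nonneg (pow_nonneg h20 0) (pow_nonneg h2c 1))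
      linear_combination w0)
      (by
      rewrite [mb1, mb2, mb12]
      have w0 := mul_nonneg (mul_nonneg (pow_nonneg h10 1) (pow_nonneg h1c 1)) (mul_nonneg (pow_nonneg h20 1) (pow_nonneg h2c 0))
      linear_combination w0)
      (by
      rewrite [mb12, mb0, mb012]
      have w0 := mul_nonneg (mul_nonneg (pow_nonneg h10 1) (pow_nonneg h1c 1)) (mul_nonneg (pow_nonneg h20 1) (pow_nonneg h2c 1))
      linear_combination w0)
      (by
      rewrite [mb02, mb1, mb012]
      have w0 := mul_nonneg (mul_nonneg (pow_nonneg h10 1) (pow_nonneg h1c 1)) (mul_nonneg (pow_nonneg h20 1) (pow_nonneg h2c 0))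
      linear_combination w0)
      (by
      rewrite [mb01, mb2, mb012]
      have w0 := mul_nonneg (mul_nonneg (pow_nonneg h10 1) (pow_nonneg h1c 1)) (mul_nonneg (pow_nonneg h20 1) (pow_nonneg h2c 0))
      linear_combination w0)
      (by
      rewrite [sahiE_three, mb012, mb12, mb02, mb01, mb0, mb1, mb2]
      have w0 := mul_nonneg (mul_nonneg (pow_nonneg h10 1) (pow_nonneg h1c 2)) (mul_nonneg (pow_nonneg h20 1) (pow_nonneg h2c 1))
      have w1 := mul_nonneg (mul_nonneg (pow_nonneg h10 1) (pow_nonneg h1c 2)) (mul_nonneg (pow_nonneg h20 2) (pow_nonneg h2c 0))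
      have w2 := mul_nonneg (mul_nonneg (pow_nonneg h10 2) (pow_nonneg h1c 1)) (mul_nonneg (pow_nonneg h20 1) (pow_nonneg h2c 1))
      have w3 := mul_nonneg (mul_nonneg (pow_nonneg h10 2) (pow_nonneg h1c 1)) (mul_nonneg (pow_nonneg h20 2) (pow_nonneg h2c 0))
      linear_combination 2 * w0 + w1 + w2 + w3)
  · exact tri 0 1 3 h.e3_013 (R 0 1) (R 0 3) (R 1 3) (R21 0 1 3) (R21b 0 1 3) (R21c 0 1 3)
      (by
      rewrite [mb0, mb1, mb01]
      have w0 := mul_nonneg (mul_nonneg (pow_nonneg h10 1) (pow_nonneg h1c 1)) (mul_nonneg (pow_nonneg h20 1) (pow_nonneg h2c 1))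
      linear_combination w0)
      (by
      rewrite [mb0, mb3, mb03]
      have w0 := mul_nonneg (mul_nonneg (pow_nonneg h10 0) (pow_nonneg h1c 1)) (mul_nonneg (pow_nonneg h20 1) (pow_nonneg h2c 1))
      linear_combination w0)
      (by
      rewrite [mb1, mb3, mb13]
      have w0 := mul_nonneg (mul_nonneg (pow_nonneg h10 1) (pow_nonneg h1c 0)) (mul_nonneg (pow_nonneg h20 1) (pow_nonneg h2c 1))
      linear_combination w0)
      (by
      rewrite [mb13, mb0, mb013]
      have w0 := mul_nonneg (mul_nonneg (pow_nonneg h10 1) (pow_nonneg h1c 1)) (mul_nonneg (pow_nonneg h20 1) (pow_nonneg h2c 1))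
      linear_combination w0)
      (by
      rewrite [mb03, mb1, mb013]
      have w0 := mul_nonneg (mul_nonneg (pow_nonneg h10 1) (pow_nonneg h1c 0)) (mul_nonneg (pow_nonneg h20 1) (pow_nonneg h2c 1))
      linear_combination w0)
      (by
      rewrite [mb01, mb3, mb013]
      have w0 := mul_nonneg (mul_nonneg (pow_nonneg h10 1) (pow_nonneg h1c 0)) (mul_nonneg (pow_nonneg h20 1) (pow_nonneg h2c 1))
      linear_combination w0)
      (by
      rewrite [sahiE_three, mb013, mb13, mb03, mb01, mb0, mb1, mb3]
      have w0 := mul_nonneg (mul_nonneg (pow_nonneg h10 1) (pow_nonneg h1c 1)) (mul_nonneg (pow_nonneg h20 1) (pow_nonneg h2c 2))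
      have w1 := mul_nonneg (mul_nonneg (pow_nonneg h10 1) (pow_nonneg h1c 1)) (mul_nonneg (pow_nonneg h20 2) (pow_nonneg h2c 1))
      have w2 := mul_nonneg (mul_nonneg (pow_nonneg h10 2) (pow_nonneg h1c 0)) (mul_nonneg (pow_nonneg h20 1) (pow_nonneg h2c 2))
      have w3 := mul_nonneg (mul_nonneg (pow_nonneg h10 2) (pow_nonneg h1c 0)) (mul_nonneg (pow_nonneg h20 2) (pow_nonneg h2c 1))
      linear_combination 2 * w0 + w1 + w2 + w3)
  · exact tri 0 2 3 h.e3_023 (R 0 2) (R 0 3) (R 2 3) (R21 0 2 3) (R21b 0 2 3) (R21c 0 2 3)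
      (by
      rewrite [mb0, mb2, mb02]
      have w0 := mul_nonneg (mul_nonneg (pow_nonneg h10 1) (pow_nonneg h1c 1)) (mul_nonneg (pow_nonneg h20 0) (pow_nonneg h2c 1))
      linear_combination w0)
      (by
      rewrite [mb0, mb3, mb03]
      have w0 := mul_nonneg (mul_nonneg (pow_nonneg h10 0) (pow_nonneg h1c 1)) (mul_nonneg (pow_nonneg h20 1) (pow_nonneg h2c 1))
      linear_combination w0)
      (by
      rewrite [mb2, mb3, mb23]
      linear_combination)
      (by
      rewrite [mb23, mb0, mb023]
      have w0 := mul_nonneg (mul_nonneg (pow_nonneg h10 1) (pow_nonneg h1c 1)) (mul_nonneg (pow_nonneg h20 1) (pow_nonneg h2c 1))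
      linear_combination w0)
      (by
      rewrite [mb03, mb2, mb023]
      linear_combination)
      (by
      rewrite [mb02, mb3, mb023]
      linear_combination)
      (by
      rewrite [sahiE_three, mb023, mb23, mb03, mb02, mb0, mb2, mb3]
      linear_combination)
  · exact tri 1 2 3 h.e3_123 (R 1 2) (R 1 3) (R 2 3) (R21 1 2 3) (R21b 1 2 3) (R21c 1 2 3)
      (by
      rewrite [mb1, mb2, mb12]
      have w0 := mul_nonneg (mul_nonneg (pow_nonneg h10 1) (pow_nonneg h1c 1)) (mul_nonneg (pow_nonneg h20 1) (pow_nonneg h2c 0))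
      linear_combination w0)
      (by
      rewrite [mb1, mb3, mb13]
      have w0 := mul_nonneg (mul_nonneg (pow_nonneg h10 1) (pow_nonneg h1c 0)) (mul_nonneg (pow_nonneg h20 1) (pow_nonneg h2c 1))
      linear_combination w0)
      (by
      rewrite [mb2, mb3, mb23]
      linear_combination)
      (by
      rewrite [mb23, mb1, mb123]
      have w0 := mul_nonneg (mul_nonneg (pow_nonneg h10 1) (pow_nonneg h1c 1)) (mul_nonneg (pow_nonneg h20 1) (pow_nonneg h2c 1))
      have w1 := mul_nonneg (mul_nonneg (pow_nonneg h10 1) (pow_nonneg h1c 1)) (mul_nonneg (pow_nonneg h20 2) (pow_nonneg h2c 0))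
      have w2 := mul_nonneg (mul_nonneg (pow_nonneg h10 2) (pow_nonneg h1c 0)) (mul_nonneg (pow_nonneg h20 1) (pow_nonneg h2c 1))
      linear_combination w0 + w1 + w2)
      (by
      rewrite [mb13, mb2, mb123]
      have w0 := mul_nonneg (mul_nonneg (pow_nonneg h10 1) (pow_nonneg h1c 1)) (mul_nonneg (pow_nonneg h20 1) (pow_nonneg h2c 0))
      linear_combination w0)
      (by
      rewrite [mb12, mb3, mb123]
      have w0 := mul_nonneg (mul_nonneg (pow_nonneg h10 1) (pow_nonneg h1c 0)) (mul_nonneg (pow_nonneg h20 1) (pow_nonneg h2c 1))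
      linear_combination w0)
      (by
      rewrite [sahiE_three, mb123, mb23, mb13, mb12, mb1, mb2, mb3]
      have w0 := mul_nonneg (mul_nonneg (pow_nonneg h10 1) (pow_nonneg h1c 1)) (mul_nonneg (pow_nonneg h20 1) (pow_nonneg h2c 1))
      have w1 := mul_nonneg (mul_nonneg (pow_nonneg h10 1) (pow_nonneg h1c 1)) (mul_nonneg (pow_nonneg h20 2) (pow_nonneg h2c 0))
      have w2 := mul_nonneg (mul_nonneg (pow_nonneg h10 2) (pow_nonneg h1c 0)) (mul_nonneg (pow_nonneg h20 1) (pow_nonneg h2c 1))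
      linear_combination 2 * w0 + w1 + w2)
  · exact sahiE_three_prodRow01_orTwoCoinX_nonneg μ ν hμ0 hμ1 hν0 hν1 hμ2 a b ha0 ha1 ham c₁ c₂ hc₁ hc₂ hind hb0 hb1 hb2 hb3 h
  · exact sahiE_three_prodRow02_orTwoCoinX_nonneg μ ν hμ0 hμ1 hν0 hν1 hμ2 a b ha0 ha1 ham c₁ c₂ hc₁ hc₂ hind hb0 hb1 hb2 hb3 h
  · exact sahiE_three_prodRow12_orTwoCoinX_nonneg μ ν hμ0 hμ1 hν0 hν1 hμ2 a b ha0 ha1 ham c₁ c₂ hc₁ hc₂ hind hb0 hb1 hb2 hb3 h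
  · exact sahiE_three_prodRow03_orTwoCoinX_nonneg μ ν hμ0 hμ1 hν0 hν1 hμ2 a b ha0 ha1 ham c₁ c₂ hc₁ hc₂ hind hb0 hb1 hb2 hb3 h
  · exact sahiE_three_prodRow13_orTwoCoinX_nonneg μ ν hμ0 hμ1 hν0 hν1 hμ2 a b ha0 ha1 ham c₁ c₂ hc₁ hc₂ hind hb0 hb1 hb2 hb3 h
  · exact sahiE_three_prodRow23_orTwoCoinX_nonneg μ ν hμ0 hμ1 hν0 hν1 hμ2 a b ha0 ha1 ham c₁ c₂ hc₁ hc₂ hind hb0 hb1 hb2 hb3 h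
  · exact sahiE_four_orTwoCoinX_nonneg μ ν hμ0 hμ1 hν0 hν1 hμ2 a b ha0 ha1 ham c₁ c₂ hc₁ hc₂ hind hb0 hb1 hb2 hb3 h

end Summit.CriticalPhenomena.PercolationContinuityZ3.Theorems.SahiH4Plus

end
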